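import Literature.Analysis.Calculus.HardyPrimitive
import Mathlib.MeasureTheory.Integral.IntegralEqImproper
import Mathlib.Topology.Order.Monotone
import HarnessLib

/-!
# Hardy's inequality with the last zero as base point:
# `∫_{t ∉ K} ‖u(t)‖²/(t - a(t))² dt ≤ 4 ∫ ‖u'‖²`, `a(t) = sup (K ∩ (-∞, t])`

Analysis/Calculus support file (everything proved; no definitions, no named facts). One-sided form
of Hardy's inequality relative to a closed set of zeros `K ⊆ ℝ` (unbounded below): all gaps of `K`
are handled at once by taking as base point the **last zero before `t`**,
`a(t) = sup (K ∩ (-∞, t])` — a monotone selection of `K` with `a(t) ≤ t`, `a(t) = t ↔ t ∈ K`, no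
point of `K` in `(a(t), t)`, and (the key to Tonelli) `a(s) = a(t)` for `s ∈ (a(t), t]`. On each
gap this is Hardy–Littlewood–Pólya, *Inequalities*, Thm. 327 at the left endpoint, with the sharp
constant `4` (`HardyPrimitive` treats `K = {0}`); the two-sided form with `dist(t, K)` is in
`HardyClosedSet`.

* `lintegral_sq_primitive_div_sq_le_lastZero` — for `f : ℝ → [0,∞]` a.e.-measurable,
  `∫⁻_{t ∉ K} (∫⁻_{(a(t), t)} f)² / (t - a(t))² ≤ 4 ∫⁻_{Kᶜ} f²` (weighted Cauchy–Schwarz of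
  `HardyPrimitive` on `(a(t), t)`, Tonelli on `{(t, s) : a(t) < s < t}`, and
  `√σ ∫_σ^∞ 2√x/x² dx = 4`, `sqrt_mul_lintegral_Ioi_kernel`);
* `lintegral_enorm_sq_div_sq_lastZero_le` — Bochner form on a window `(t₀, t₁)`, `t₀ ∈ K`:
  if `u(t) = ∫_{a(t)}^t h` off `K` then `∫⁻_{(t₀,t₁) ∖ K} ‖u‖²/(t - a(t))² ≤ 4 ∫⁻_{(t₀,t₁)} ‖h‖²`.

## Mathlib / tree search

Mathlib: no Hardy inequality; `IsClosed.csSup_mem`, `Monotone.measurable`,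
`MeasureTheory.integral_Ioi_of_hasDerivAt_of_nonneg'`. Tree: `HardyPrimitive`
(`lintegral_Ioo_sq_le_sqrt_mul`, `setLIntegral_Ioo_comp_add_right`).

## References

* G. H. Hardy, J. E. Littlewood, G. Pólya, *Inequalities*, 2nd ed., Cambridge (1952), Thm. 327.
  [HardyLittlewoodPolya1952]
* V. Maz'ya, *Sobolev Spaces*, 2nd ed., Springer (2011), §2.3.3.
-/

noncomputable section

open MeasureTheory Set Filter Metric
open scoped ENNReal NNReal Topology

namespace Literature.Analysis.Calculus

/-! ## The last zero before `t` -/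

section LastZero

variable {K : Set ℝ}

/-- `a(t) = sup (K ∩ (-∞, t]) ≤ t`. [folklore] -/
theorem sSup_inter_Iic_le {t : ℝ} (hne : (K ∩ Iic t).Nonempty) : sSup (K ∩ Iic t) ≤ t :=
  csSup_le hne fun _ hs => hs.2

/-- A point of `K` left of `t` is at most `a(t)`. [folklore] -/
theorem le_sSup_inter_Iic {s t : ℝ} (hs : s ∈ K) (hst : s ≤ t) : s ≤ sSup (K ∩ Iic t) :=
  le_csSup ⟨t, fun _ hr => hr.2⟩ ⟨hs, hst⟩

/-- For closed `K`, `a(t) ∈ K`. [folklore] -/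
theorem sSup_inter_Iic_mem (hK : IsClosed K) {t : ℝ} (hne : (K ∩ Iic t).Nonempty) :
    sSup (K ∩ Iic t) ∈ K :=
  ((hK.inter isClosed_Iic).csSup_mem hne ⟨t, fun _ hs => hs.2⟩).1

/-- `a(t) = t` for `t ∈ K`. [folklore] -/
theorem sSup_inter_Iic_eq_self {t : ℝ} (ht : t ∈ K) : sSup (K ∩ Iic t) = t :=
  le_antisymm (sSup_inter_Iic_le ⟨t, ht, self_mem_Iic⟩) (le_sSup_inter_Iic ht le_rfl)

/-- For closed `K` and `t ∉ K`, `a(t) < t`. [folklore] -/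
theorem sSup_inter_Iic_lt (hK : IsClosed K) {t : ℝ} (hne : (K ∩ Iic t).Nonempty) (ht : t ∉ K) :
    sSup (K ∩ Iic t) < t :=
  lt_of_le_of_ne (sSup_inter_Iic_le hne) fun h => ht (h ▸ sSup_inter_Iic_mem hK hne)

/-- No point of `K` lies in `(a(t), t]` strictly above `a(t)`: `s ∈ (a(t), t] → s ∉ K`. [folklore] -/
theorem not_mem_of_mem_Ioc_sSup_inter_Iic {s t : ℝ} (hs : s ∈ Ioc (sSup (K ∩ Iic t)) t) : s ∉ K :=
  fun hsK => (not_lt.2 (le_sSup_inter_Iic hsK hs.2)) hs.1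

/-- `t ↦ a(t)` is monotone when `K` is unbounded below. [folklore] -/
theorem monotone_sSup_inter_Iic (hne : ∀ t : ℝ, (K ∩ Iic t).Nonempty) :
    Monotone fun t : ℝ => sSup (K ∩ Iic t) := fun _ t' htt' =>
  csSup_le_csSup ⟨t', fun _ hs => hs.2⟩ (hne _) (inter_subset_inter_right _ (Iic_subset_Iic.2 htt'))

/-- **The last zero is constant on each gap**: `a(s) = a(t)` for `s ∈ (a(t), t]`. [folklore] -/
theorem sSup_inter_Iic_eq_of_mem_Ioc (hne : ∀ t : ℝ, (K ∩ Iic t).Nonempty) {s t : ℝ}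
    (hs : s ∈ Ioc (sSup (K ∩ Iic t)) t) : sSup (K ∩ Iic s) = sSup (K ∩ Iic t) := by
  refine le_antisymm (monotone_sSup_inter_Iic hne hs.2) (csSup_le (hne t) fun r hr => ?_)
  exact le_sSup_inter_Iic hr.1 ((le_sSup_inter_Iic hr.1 hr.2).trans_lt hs.1).le

/-- Reflection: `sup ((-K) ∩ (-∞, -t]) = -inf (K ∩ [t, ∞))`. [folklore] -/
theorem sSup_neg_inter_Iic (K : Set ℝ) (t : ℝ) : sSup (-K ∩ Iic (-t)) = -sInf (K ∩ Ici t) := by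
  have h : -K ∩ Iic (-t) = -(K ∩ Ici t) := by
    ext s
    simp only [mem_inter_iff, Set.mem_neg, mem_Iic, mem_Ici, le_neg]
  rw [h, Real.sSup_neg]

/-- Reflection, second form: `sup ((-K) ∩ (-∞, t]) = -inf (K ∩ [-t, ∞))`. [folklore] -/
theorem sSup_neg_inter_Iic' (K : Set ℝ) (t : ℝ) : sSup (-K ∩ Iic t) = -sInf (K ∩ Ici (-t)) := by
  have := sSup_neg_inter_Iic K (-t)
  rwa [neg_neg] at this

/-- `(-K) ∩ (-∞, t]` is nonempty when `K ∩ [-t, ∞)` is. [folklore] -/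
theorem neg_inter_Iic_nonempty {t : ℝ} (h : (K ∩ Ici (-t)).Nonempty) : (-K ∩ Iic t).Nonempty := by
  obtain ⟨k, hk⟩ := h
  exact ⟨-k, by simpa using hk.1, mem_Iic.2 (neg_le.2 hk.2)⟩

end LastZero

/-! ## The kernel integral on a half-line -/

/-- `√σ ∫_{(σ, ∞)} 2√x/x² dx = 4` for `0 < σ` (improper integral of the derivative of `-4/√x`).
[folklore] -/
theorem sqrt_mul_lintegral_Ioi_kernel {σ : ℝ} (hσ : 0 < σ) :
    ENNReal.ofReal (√σ) * ∫⁻ x in Ioi σ, ENNReal.ofReal (2 * √x / x ^ 2) = 4 := by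
  have hderiv : ∀ x ∈ Ici σ, HasDerivAt (fun y : ℝ => -4 * (√y)⁻¹) (2 * √x / x ^ 2) x := by
    intro x hx
    have hx0 : 0 < x := hσ.trans_le hx
    have hsx : √x ≠ 0 := (Real.sqrt_pos.2 hx0).ne'
    have h := ((Real.hasDerivAt_sqrt hx0.ne').inv hsx).const_mul (-4)
    have heq : -4 * (-(1 / (2 * √x)) / √x ^ 2) = 2 * √x / x ^ 2 := by
      rw [Real.sq_sqrt hx0.le]
      field_simp
      rw [Real.sq_sqrt hx0.le]
      ring
    rwa [heq] at h
  have hpos : ∀ x ∈ Ioi σ, 0 ≤ 2 * √x / x ^ 2 := fun x _ => by positivity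
  have hlim : Tendsto (fun y : ℝ => -4 * (√y)⁻¹) atTop (𝓝 (-4 * 0)) :=
    (tendsto_inv_atTop_zero.comp Real.tendsto_sqrt_atTop).const_mul (-4)
  have hint : IntegrableOn (fun x : ℝ => 2 * √x / x ^ 2) (Ioi σ) volume :=
    integrableOn_Ioi_deriv_of_nonneg' hderiv hpos hlim
  have hval : ∫ x in Ioi σ, 2 * √x / x ^ 2 = -4 * 0 - -4 * (√σ)⁻¹ :=
    integral_Ioi_of_hasDerivAt_of_nonneg' hderiv hpos hlim
  rw [← ofReal_integral_eq_lintegral_ofReal hint ((ae_restrict_iff' measurableSet_Ioi).2 (ae_of_all _ hpos)),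
    hval, ← ENNReal.ofReal_mul (Real.sqrt_nonneg _)]
  have h4 : √σ * (-4 * 0 - -4 * (√σ)⁻¹) = 4 := by
    rw [mul_zero, zero_sub, neg_mul, neg_neg, mul_comm 4, ← mul_assoc,
      mul_inv_cancel₀ (Real.sqrt_pos.2 hσ).ne', one_mul]
  rw [h4]
  norm_num

/-- The weighted Cauchy–Schwarz inequality of `HardyPrimitive` on a translated interval:
`(∫_{(a,t)} f)² ≤ 2√(t-a) ∫_{(a,t)} √(s-a) f(s)² ds` (`a < t`). [folklore] -/
theorem lintegral_Ioo_sq_le_sqrt_mul_translate {f : ℝ → ℝ≥0∞} (hf : AEMeasurable f volume) {a t : ℝ}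
    (hat : a < t) :
    (∫⁻ s in Ioo a t, f s) ^ 2 ≤
      ENNReal.ofReal (2 * √(t - a)) * ∫⁻ s in Ioo a t, ENNReal.ofReal (√(s - a)) * f s ^ 2 := by
  have h1 : ∫⁻ s in Ioo a t, f s = ∫⁻ σ in Ioo 0 (t - a), f (σ + a) := by
    rw [setLIntegral_Ioo_comp_add_right (fun s => f s) a (t - a), add_sub_cancel]
  have h2 : ∫⁻ s in Ioo a t, ENNReal.ofReal (√(s - a)) * f s ^ 2 =
      ∫⁻ σ in Ioo 0 (t - a), ENNReal.ofReal (√σ) * f (σ + a) ^ 2 := by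
    rw [← add_sub_cancel a t, ← setLIntegral_Ioo_comp_add_right
      (fun s => ENNReal.ofReal (√(s - a)) * f s ^ 2) a (t - a), add_sub_cancel]
    simp only [add_sub_cancel_right]
  have hf' : AEMeasurable (fun σ : ℝ => f (σ + a)) (volume.restrict (Ioo 0 (t - a))) :=
    (hf.comp_quasiMeasurePreserving
      (measurePreserving_add_right volume a).quasiMeasurePreserving).restrict
  rw [h1, h2]
  exact lintegral_Ioo_sq_le_sqrt_mul (sub_pos.2 hat) hf'

/-! ## Hardy's inequality with the last zero as base point -/

/-- **Hardy's inequality relative to a closed set, `[0, ∞]`-valued form.** Let `K ⊆ ℝ` be closed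
and unbounded below, `a(t) = sup (K ∩ (-∞, t])` the last point of `K` before `t`, and
`f : ℝ → [0, ∞]` a.e.-measurable. Then
`∫⁻_{t ∉ K} (∫⁻_{(a(t), t)} f)² / (t - a(t))² dt ≤ 4 ∫⁻_{Kᶜ} f²`.
On each gap of `K` this is Hardy–Littlewood–Pólya Thm. 327 at the left endpoint; the gaps are
handled simultaneously by Tonelli on `{(t, s) : a(t) < s < t}`, where `a(s) = a(t)`.
[cite: HardyLittlewoodPolya1952, Thm. 327] -/
theorem lintegral_sq_primitive_div_sq_le_lastZero {K : Set ℝ} (hK : IsClosed K)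
    (hne : ∀ t : ℝ, (K ∩ Iic t).Nonempty) {f : ℝ → ℝ≥0∞} (hf : AEMeasurable f volume) :
    ∫⁻ t in Kᶜ, (∫⁻ s in Ioo (sSup (K ∩ Iic t)) t, f s) ^ 2 /
        ENNReal.ofReal ((t - sSup (K ∩ Iic t)) ^ 2) ≤ 4 * ∫⁻ s in Kᶜ, f s ^ 2 := by
  set a : ℝ → ℝ := fun t => sSup (K ∩ Iic t) with ha_def
  have ha_meas : Measurable a := (monotone_sSup_inter_Iic hne).measurable
  have ha_lt : ∀ t ∉ K, a t < t := fun t ht => sSup_inter_Iic_lt hK (hne t) ht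
  have hgap : ∀ t, ∀ s ∈ Ioo (a t) t, s ∉ K := fun t s hs =>
    not_mem_of_mem_Ioc_sSup_inter_Iic ⟨hs.1, hs.2.le⟩
  have ha_eq : ∀ t, ∀ s ∈ Ioo (a t) t, a s = a t := fun t s hs =>
    sSup_inter_Iic_eq_of_mem_Ioc hne ⟨hs.1, hs.2.le⟩
  -- kernel and weight
  set c : ℝ → ℝ≥0∞ := fun x => ENNReal.ofReal (2 * √x / x ^ 2) with hc_def
  set w : ℝ → ℝ≥0∞ := fun y => ENNReal.ofReal (√y) with hw_def
  have hc : Measurable c := by simp only [hc_def]; fun_prop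
  have hw : Measurable w := by simp only [hw_def]; fun_prop
  -- the region `R = {(t, s) : t ∉ K, a t < s < t}` and the integrand on it
  set R : Set (ℝ × ℝ) := {p | p.1 ∉ K ∧ a p.1 < p.2 ∧ p.2 < p.1} with hR_def
  have hRm : MeasurableSet R := by
    simp only [hR_def]
    refine (hK.measurableSet.compl.preimage measurable_fst).inter
      ((measurableSet_lt (ha_meas.comp measurable_fst) measurable_snd).inter
        (measurableSet_lt measurable_snd measurable_fst))
  set Φ : ℝ × ℝ → ℝ≥0∞ := R.indicator fun p => c (p.1 - a p.1) * (w (p.2 - a p.1) * f p.2 ^ 2)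
    with hΦ_def
  have hΦm : AEMeasurable Φ ((volume : Measure ℝ).prod (volume : Measure ℝ)) := by
    refine AEMeasurable.indicator ?_ hRm
    have hf2 : AEMeasurable (fun p : ℝ × ℝ => f p.2) ((volume : Measure ℝ).prod (volume : Measure ℝ)) :=
      hf.comp_quasiMeasurePreserving Measure.quasiMeasurePreserving_snd
    exact ((hc.comp (measurable_fst.sub (ha_meas.comp measurable_fst))).aemeasurable).mul
      (((hw.comp (measurable_snd.sub (ha_meas.comp measurable_fst))).aemeasurable).mul (hf2.pow_const 2))
  -- Step 1: pointwise bound for `t ∉ K`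
  have hpt : ∀ t ∈ Kᶜ, (∫⁻ s in Ioo (a t) t, f s) ^ 2 / ENNReal.ofReal ((t - a t) ^ 2) ≤
      ∫⁻ s, Φ (t, s) := by
    intro t ht
    have hat : a t < t := ha_lt t ht
    have hsec : ∀ s, Φ (t, s) = (Ioo (a t) t).indicator (fun s => c (t - a t) * (w (s - a t) * f s ^ 2)) s := by
      intro s
      by_cases h : a t < s ∧ s < t
      · have hR : (t, s) ∈ R := ⟨ht, h.1, h.2⟩
        rw [hΦ_def, indicator_of_mem hR, indicator_of_mem (show s ∈ Ioo (a t) t from h)]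
      · have hR : (t, s) ∉ R := fun h' => h ⟨h'.2.1, h'.2.2⟩
        rw [hΦ_def, indicator_of_notMem hR, indicator_of_notMem (show s ∉ Ioo (a t) t from h)]
    simp_rw [hsec]
    rw [lintegral_indicator measurableSet_Ioo, lintegral_const_mul' _ _ ENNReal.ofReal_ne_top]
    have hx2 : 0 < (t - a t) ^ 2 := pow_pos (sub_pos.2 hat) 2
    rw [ENNReal.ofReal_div_of_pos hx2, ENNReal.div_eq_inv_mul, ENNReal.div_eq_inv_mul, mul_assoc]
    gcongr
    exact lintegral_Ioo_sq_le_sqrt_mul_translate hf hat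
  -- Step 2: the `t`-integral for fixed `s`
  have hinner : ∀ s, ∫⁻ t, Φ (t, s) ≤ Kᶜ.indicator (fun s => 4 * f s ^ 2) s := by
    intro s
    by_cases hsK : s ∈ K
    · have h0 : ∀ t, Φ (t, s) = 0 := by
        intro t
        rw [hΦ_def, indicator_of_notMem]
        rintro ⟨-, h1, h2⟩
        exact hgap t s ⟨h1, h2⟩ hsK
      have h0' : (fun t => Φ (t, s)) = fun _ => 0 := funext h0
      rw [h0', lintegral_zero]
      exact zero_le
    · rw [indicator_of_mem (mem_compl hsK)]
      have hσ : 0 < s - a s := sub_pos.2 (ha_lt s hsK)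
      have hle : ∀ t, Φ (t, s) ≤ (Ioi s).indicator (fun t => c (t - a s) * (w (s - a s) * f s ^ 2)) t := by
        intro t
        by_cases h : (t, s) ∈ R
        · rw [hΦ_def, indicator_of_mem h, indicator_of_mem (show t ∈ Ioi s from h.2.2),
            ha_eq t s ⟨h.2.1, h.2.2⟩]
        · rw [hΦ_def, indicator_of_notMem h]
          exact zero_le
      calc ∫⁻ t, Φ (t, s) ≤ ∫⁻ t, (Ioi s).indicator (fun t => c (t - a s) * (w (s - a s) * f s ^ 2)) t :=
            lintegral_mono hle
        _ = (∫⁻ t in Ioi s, c (t - a s)) * (w (s - a s) * f s ^ 2) := by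
            rw [lintegral_indicator measurableSet_Ioi,
              lintegral_mul_const _ (show Measurable (fun t : ℝ => c (t - a s)) from
                hc.comp (measurable_id.sub_const _))]
        _ = (w (s - a s) * ∫⁻ x in Ioi (s - a s), c x) * f s ^ 2 := by
            have htr : ∫⁻ t in Ioi s, c (t - a s) = ∫⁻ x in Ioi (s - a s), c x := by
              have h := (measurePreserving_add_right volume (-a s)).setLIntegral_comp_preimage_emb
                (measurableEmbedding_addRight (-a s)) c (Ioi (s - a s))
              rw [preimage_add_const_Ioi, sub_neg_eq_add, sub_add_cancel] at h
              simpa only [← sub_eq_add_neg] using h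
            rw [htr]
            ring
        _ = 4 * f s ^ 2 := by
            simp only [hw_def, hc_def]
            rw [sqrt_mul_lintegral_Ioi_kernel hσ]
  -- Step 3: assemble
  calc ∫⁻ t in Kᶜ, (∫⁻ s in Ioo (a t) t, f s) ^ 2 / ENNReal.ofReal ((t - a t) ^ 2)
      ≤ ∫⁻ t in Kᶜ, ∫⁻ s, Φ (t, s) := setLIntegral_mono' hK.measurableSet.compl hpt
    _ ≤ ∫⁻ t, ∫⁻ s, Φ (t, s) := setLIntegral_le_lintegral _ _
    _ = ∫⁻ s, ∫⁻ t, Φ (t, s) := lintegral_lintegral_swap hΦm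
    _ ≤ ∫⁻ s, Kᶜ.indicator (fun s => 4 * f s ^ 2) s := lintegral_mono hinner
    _ = 4 * ∫⁻ s in Kᶜ, f s ^ 2 := by
        rw [lintegral_indicator hK.measurableSet.compl, lintegral_const_mul' _ _ (by norm_num)]

/-! ## Bochner forms on a window -/

section Bochner

variable {E : Type*} [NormedAddCommGroup E] [NormedSpace ℝ E]

/-- **Hardy relative to the last zero, Bochner form.** `K` closed and unbounded below,
`a(t) = sup (K ∩ (-∞, t])`; a window `(t₀, t₁)` with `t₀ ∈ K`; `h` a.e.-strongly measurable on the
window and `u(t) = ∫_{a(t)}^t h` for `t ∈ (t₀, t₁) ∖ K` (e.g. `u` absolutely continuous with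
derivative `h` and `u = 0` on `K`). Then
`∫⁻_{(t₀,t₁) ∖ K} ‖u(t)‖² / (t - a(t))² ≤ 4 ∫⁻_{(t₀,t₁)} ‖h‖²`. [cite: HardyLittlewoodPolya1952, Thm. 327] -/
theorem lintegral_enorm_sq_div_sq_lastZero_le {K : Set ℝ} (hK : IsClosed K)
    (hne : ∀ t : ℝ, (K ∩ Iic t).Nonempty) {t₀ t₁ : ℝ} (ht₀ : t₀ ∈ K) {u h : ℝ → E}
    (hh : AEStronglyMeasurable h (volume.restrict (Ioo t₀ t₁)))
    (hu : ∀ t ∈ Ioo t₀ t₁ \ K, u t = ∫ s in (sSup (K ∩ Iic t))..t, h s) :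
    ∫⁻ t in Ioo t₀ t₁ \ K, ‖u t‖ₑ ^ 2 / ENNReal.ofReal ((t - sSup (K ∩ Iic t)) ^ 2) ≤
      4 * ∫⁻ t in Ioo t₀ t₁, ‖h t‖ₑ ^ 2 := by
  set f : ℝ → ℝ≥0∞ := (Ioo t₀ t₁).indicator fun s => ‖h s‖ₑ with hf_def
  have hfm : AEMeasurable f volume := by
    simp only [hf_def]
    exact (aemeasurable_indicator_iff measurableSet_Ioo).2 hh.enorm
  -- pointwise: `‖u t‖ ≤ ∫⁻_{(a t, t)} f`
  have hpt : ∀ t ∈ Ioo t₀ t₁ \ K, ‖u t‖ₑ ≤ ∫⁻ s in Ioo (sSup (K ∩ Iic t)) t, f s := by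
    intro t ht
    have hat : sSup (K ∩ Iic t) < t := sSup_inter_Iic_lt hK (hne t) ht.2
    have ha0 : t₀ ≤ sSup (K ∩ Iic t) := le_sSup_inter_Iic ht₀ ht.1.1.le
    have hsub : Ioo (sSup (K ∩ Iic t)) t ⊆ Ioo t₀ t₁ := Ioo_subset_Ioo ha0 ht.1.2.le
    rw [hu t ht, intervalIntegral.integral_of_le hat.le, integral_Ioc_eq_integral_Ioo]
    calc ‖∫ s in Ioo (sSup (K ∩ Iic t)) t, h s‖ₑ ≤ ∫⁻ s in Ioo (sSup (K ∩ Iic t)) t, ‖h s‖ₑ :=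
          enorm_integral_le_lintegral_enorm _
      _ = ∫⁻ s in Ioo (sSup (K ∩ Iic t)) t, f s :=
          setLIntegral_congr_fun measurableSet_Ioo fun s hs => by
            simp only [hf_def, indicator_of_mem (hsub hs)]
  calc ∫⁻ t in Ioo t₀ t₁ \ K, ‖u t‖ₑ ^ 2 / ENNReal.ofReal ((t - sSup (K ∩ Iic t)) ^ 2)
      ≤ ∫⁻ t in Ioo t₀ t₁ \ K, (∫⁻ s in Ioo (sSup (K ∩ Iic t)) t, f s) ^ 2 /
          ENNReal.ofReal ((t - sSup (K ∩ Iic t)) ^ 2) := by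
        refine setLIntegral_mono' (measurableSet_Ioo.diff hK.measurableSet) fun t ht => ?_
        gcongr
        exact hpt t ht
    _ ≤ ∫⁻ t in Kᶜ, (∫⁻ s in Ioo (sSup (K ∩ Iic t)) t, f s) ^ 2 /
          ENNReal.ofReal ((t - sSup (K ∩ Iic t)) ^ 2) :=
        lintegral_mono_set fun t ht => ht.2
    _ ≤ 4 * ∫⁻ s in Kᶜ, f s ^ 2 := lintegral_sq_primitive_div_sq_le_lastZero hK hne hfm
    _ ≤ 4 * ∫⁻ s, f s ^ 2 := mul_le_mul_right (setLIntegral_le_lintegral _ _) _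
    _ = 4 * ∫⁻ t in Ioo t₀ t₁, ‖h t‖ₑ ^ 2 := by
        congr 1
        rw [← lintegral_indicator measurableSet_Ioo]
        refine lintegral_congr fun s => ?_
        simp only [hf_def, indicator_apply]
        split_ifs <;> simp

end Bochner

end Literature.Analysis.Calculus

end
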